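import Summits.HubbardSuperconductivity.HubbardSuperconductivity.Theorems.BirComplexStableXY.Negative.WitnessTable
import Literature.MathematicalPhysics.QuantumFieldTheory.TorusChartCochains
import Mathlib.LinearAlgebra.BilinearMap
import HarnessLib

/-!
# Route `BalabanIR`, crux `BirComplexStableXYR` (item `stmt-HubbardSuperconductivity-14845`),
# line `fat-gaussian-defect-calculus`: stub R4 `stub_thinFormPolar`

Helper (`--supports`) for the crux
`Summit.HubbardSuperconductivity.HubbardSuperconductivity.Theses.BalabanIR.BirComplexStableXYR`,
line `fat-gaussian-defect-calculus`, stub R4 `stub_thinFormPolar`: **the polar (symmetric bilinear) form of the thin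
Gaussian form** on real `1`-cochains of the space–time torus `Λ L M = (Fin 2 → ZMod L) × ZMod M` (chart
`TorusChart.piProdZMod 2 L M`: directions `0, 1` spatial, `2` temporal).

**Statement.** For a window Fourier table `c : Table r`, a window path configuration `P` (given through its defining
hypothesis: `P ω s w` is the staircase line sum of `ω` from the corner `s` — `w.1` edges in direction `0`, then `w.2.1`
in direction `1`, then `w.2.2` in direction `2`) and the window Hessian form `Q u = Re(−Σ_n c_n (n·u)²)` (also through
its defining hypothesis), there is a real bilinear form `B` on `Λ L M → Fin 3 → ℝ` which is symmetric and whose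
diagonal is the thin form: `B ω ω = Σ_s Q (P ω s)`.

**Proof.** `lineSum` is additive and homogeneous in the cochain, hence so is `ω ↦ P ω s w` and therefore every
functional `ℓ_{s,n}(ω) = Σ_w n_w · P ω s w`.  For real `x`, `Re(−Σ_n c_n x_n) = Σ_{n ∈ supp c} Re(−c_n) x_n`
(`thinFormPolar_re_neg_sum`), so `Q(P ω s) = Σ_n Re(−c_n) ℓ_{s,n}(ω)²` is a signed sum of squares of linear
functionals, and `B(ω, ω') := Σ_s Σ_{n ∈ supp c} Re(−c_n) ℓ_{s,n}(ω) ℓ_{s,n}(ω')` (packaged with `LinearMap.mk₂`) is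
bilinear, symmetric, with the required diagonal.  Elementary finite-sum bookkeeping; no definition and no named fact
is introduced; sorry-free. [folklore]
-/

set_option linter.dupNamespace false -- `Summit.<S>.<S>.Theorems…` repeats the summit name (D-0017 layout)

namespace Summit.HubbardSuperconductivity.HubbardSuperconductivity.Theorems.FSUnfolding

open scoped BigOperators
open Literature.MathematicalPhysics.QuantumFieldTheory Literature.Probability.LatticeModels
open Summit.HubbardSuperconductivity.BirComplexStableXYNegative

/-- **Real part of a negated table sum with real weights.**  For a finitely supported complex table `c` and real
numbers `x n`: `Re(−Σ_n c_n · x_n) = Σ_{n ∈ supp c} Re(−c_n) · x_n`. [folklore] -/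
theorem thinFormPolar_re_neg_sum {ι : Type*} (c : ι →₀ ℂ) (x : ι → ℝ) :
    (-c.sum (fun n a => a * ((x n : ℝ) : ℂ))).re = ∑ n ∈ c.support, (-(c n)).re * x n := by
  rw [Finsupp.sum, ← Finset.sum_neg_distrib, Complex.re_sum]
  refine Finset.sum_congr rfl fun n _ => ?_
  rw [Complex.neg_re, Complex.re_mul_ofReal, Complex.neg_re, neg_mul]

/-- **The window Hessian form is a signed sum of squares.**  For a window table `c : Table r` and a real window
configuration `u`: `Re(−Σ_n c_n (n·u)²) = Σ_{n ∈ supp c} Re(−c_n) (n·u)²`, `n·u = Σ_w n_w u_w`. [folklore] -/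
theorem thinFormPolar_hessRe_eq {r : ℕ} (c : Table r) (u : W r → ℝ) :
    (-c.sum (fun n a => a * (((∑ w, (n w : ℝ) * u w) ^ 2 : ℝ) : ℂ))).re
      = ∑ n ∈ c.support, (-(c n)).re * (∑ w, (n w : ℝ) * u w) ^ 2 :=
  thinFormPolar_re_neg_sum c fun n => (∑ w, (n w : ℝ) * u w) ^ 2

/-- **Stub R4 `stub_thinFormPolar` (registered signature, verbatim): the polar (bilinear) form of the thin Gaussian
form.**  The thin form `ω ↦ Σ_s Q(P_s ω)` on real `1`-cochains is a quadratic form: there is a symmetric real bilinear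
form `B` with `B ω ω = Σ_s Q(P_s ω)` (`P_s` is linear in `ω` — `lineSum` is additive and homogeneous —, and
`Q(u) = Σ_{n ∈ supp c} Re(−c_n)·(n·u)²` is a signed sum of squares of linear functionals;
`B(ω, ω') := Σ_s Σ_n Re(−c_n)(n·P_s ω)(n·P_s ω')`).  This is what the square completion `stub_bilinSquare`
consumes. [folklore] -/
theorem stub_thinFormPolar :
    ∀ (r : ℕ) (c : Table r) (L M : ℕ) [NeZero L] [NeZero M]
      (P : (Λ L M → Fin 3 → ℝ) → Λ L M → W r → ℝ),
      (∀ (ω : Λ L M → Fin 3 → ℝ) (s : Λ L M) (w : W r), P ω s w =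
        (TorusChart.piProdZMod 2 L M).lineSum ω 0 (w.1 : ℕ) s
          + (TorusChart.piProdZMod 2 L M).lineSum ω 1 (w.2.1 : ℕ) (s + (w.1 : ℕ) • (TorusChart.piProdZMod 2 L M).gen 0)
          + (TorusChart.piProdZMod 2 L M).lineSum ω 2 (w.2.2 : ℕ)
            (s + (w.1 : ℕ) • (TorusChart.piProdZMod 2 L M).gen 0 + (w.2.1 : ℕ) • (TorusChart.piProdZMod 2 L M).gen 1)) →
      ∀ (Q : (W r → ℝ) → ℝ),
      (∀ u : W r → ℝ, Q u = (-c.sum (fun n a => a * (((∑ w, (n w : ℝ) * u w) ^ 2 : ℝ) : ℂ))).re) →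
      ∃ B : (Λ L M → Fin 3 → ℝ) →ₗ[ℝ] (Λ L M → Fin 3 → ℝ) →ₗ[ℝ] ℝ,
        (∀ ω ω' : Λ L M → Fin 3 → ℝ, B ω ω' = B ω' ω) ∧
        ∀ ω : Λ L M → Fin 3 → ℝ, B ω ω = ∑ s : Λ L M, Q (P ω s) := by
  intro r c L M _ _ P hP Q hQ
  -- (1) `P` is additive and homogeneous in the cochain.
  have hPadd : ∀ (ω ω' : Λ L M → Fin 3 → ℝ) (s : Λ L M) (w : W r),
      P (ω + ω') s w = P ω s w + P ω' s w := by
    intro ω ω' s w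
    rw [hP (ω + ω'), hP ω, hP ω', TorusChart.lineSum_add, TorusChart.lineSum_add, TorusChart.lineSum_add]
    abel
  have hPsmul : ∀ (t : ℝ) (ω : Λ L M → Fin 3 → ℝ) (s : Λ L M) (w : W r),
      P (t • ω) s w = t * P ω s w := by
    intro t ω s w
    rw [hP (t • ω), hP ω]
    simp only [TorusChart.lineSum, Pi.smul_apply, smul_eq_mul, Finset.mul_sum, mul_add]
  -- the linear functionals `ℓ s n ω = Σ_w n_w · P ω s w` (kept opaque through `hℓ`)
  obtain ⟨ℓ, hℓ⟩ : ∃ ℓ : Λ L M → (W r → ℤ) → (Λ L M → Fin 3 → ℝ) → ℝ,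
      ∀ s n ω, ℓ s n ω = ∑ w, (n w : ℝ) * P ω s w := ⟨_, fun _ _ _ => rfl⟩
  have hℓadd : ∀ (s : Λ L M) (n : W r → ℤ) (ω ω' : Λ L M → Fin 3 → ℝ),
      ℓ s n (ω + ω') = ℓ s n ω + ℓ s n ω' := by
    intro s n ω ω'
    simp only [hℓ, hPadd, mul_add, Finset.sum_add_distrib]
  have hℓsmul : ∀ (s : Λ L M) (n : W r → ℤ) (t : ℝ) (ω : Λ L M → Fin 3 → ℝ),
      ℓ s n (t • ω) = t * ℓ s n ω := by
    intro s n t ω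
    simp only [hℓ, hPsmul, Finset.mul_sum]
    exact Finset.sum_congr rfl fun w _ => by ring
  -- (3) the polar form, packaged with `LinearMap.mk₂`.
  refine ⟨LinearMap.mk₂ ℝ
      (fun ω ω' => ∑ s : Λ L M, ∑ n ∈ c.support, (-(c n)).re * (ℓ s n ω * ℓ s n ω'))
      ?_ ?_ ?_ ?_, ?_, ?_⟩
  · intro ω₁ ω₂ ω'
    simp only [hℓadd, add_mul, mul_add, Finset.sum_add_distrib]
  · intro t ω ω'
    simp only [hℓsmul, smul_eq_mul, Finset.mul_sum]
    exact Finset.sum_congr rfl fun s _ => Finset.sum_congr rfl fun n _ => by ring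
  · intro ω ω₁ ω₂
    simp only [hℓadd, mul_add, Finset.sum_add_distrib]
  · intro t ω ω'
    simp only [hℓsmul, smul_eq_mul, Finset.mul_sum]
    exact Finset.sum_congr rfl fun s _ => Finset.sum_congr rfl fun n _ => by ring
  · -- symmetry
    intro ω ω'
    simp only [LinearMap.mk₂_apply]
    exact Finset.sum_congr rfl fun s _ => Finset.sum_congr rfl fun n _ => by ring
  · -- (2) the diagonal is the thin form
    intro ω
    simp only [LinearMap.mk₂_apply]
    refine Finset.sum_congr rfl fun s _ => ?_
    rw [hQ, thinFormPolar_hessRe_eq]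
    refine Finset.sum_congr rfl fun n _ => ?_
    rw [hℓ, sq]

end Summit.HubbardSuperconductivity.HubbardSuperconductivity.Theorems.FSUnfolding
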